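import Mathlib.Analysis.SpecialFunctions.Stirling
import Summits.AtomisticToContinuum.HydrodynamicLimit.Theorems.CollisionIsometryCLTHsFreeEnergyConvexBasic
import HarnessLib

/-!
# Ruelle convexity for the tree's `limsup` free energy — Stirling bookkeeping of the master inequality

Support file (`--supports stmt-AtomisticToContinuum-14870`) of the lead of the line `IdeatorTwoGen1Sketch`
for the crux `MacroClosure`; part of the assembly of the registered stub `stub_ruelleConvexity`.

Taking logarithms in the master inequality of the sub-cube decomposition
(`RuelleMaster.master`, file `…RuelleMaster.lean`),

`N!/(n₁!^{J₁} n₂!^{J₂} n₄! R!) · s^{3N} · FV(η₁,n₁)^{J₁} FV(η₂,n₂)^{J₂} FV(η₂,n₄) FV(6/5,R) ≤ FV(η, N)`,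

and pricing the factorials by Stirling (`log N! ≥ N log N − N`, `log m! ≤ m log m − m + 1 + ½ log m`,
Mathlib's `Stirling`), the rate `a_N(η) = −N⁻¹ log FV(η, N)` is bounded by the entropy of mixing plus
the weighted rates of the cells (`RuelleEstimate.rate_le`):

`a_N(η) ≤ x₁ (log(η₁/η) + a_{n₁}(η₁)) + x₂ (log(η₂/η) + a_{n₂}(η₂)) + (n₄/N)(log(η₂/η) + a_{n₄}(η₂))
        + (R/N)(log 2 + a_R(6/5)) + k³ (1 + ½ log N)/N`,   `x₁ = J₁n₁/N`, `x₂ = J₂n₂/N`,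

using the local density constraints `nᵢ η ≤ ηᵢ s³ N` in the form `log (nᵢ/(N s³)) ≤ log (ηᵢ/η)` and
`R ≤ 2 s³ N`. Pure real analysis; no measure theory.

Reference: D. Ruelle, *Statistical Mechanics: Rigorous Results* (1969), §3.4.
-/

noncomputable section

open Filter Set Topology

namespace Summit.AtomisticToContinuum.HydrodynamicLimit.Theorems.MacroClosureLine

open Literature.MathematicalPhysics.KineticTheory

namespace Barycentric

namespace RuelleEstimate

/-! ### Stirling bounds -/

/-- Lower Stirling bound: `N log N − N ≤ log N!` (`N ≥ 1`). -/
theorem log_factorial_ge {N : ℕ} (hN : N ≠ 0) : (N : ℝ) * Real.log N - N ≤ Real.log N.factorial := by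
  have h := Stirling.le_log_factorial_stirling hN
  have h1 : 0 ≤ Real.log N := Real.log_nonneg (by exact_mod_cast Nat.one_le_iff_ne_zero.2 hN)
  have h2 : 0 ≤ Real.log (2 * Real.pi) := Real.log_nonneg (by linarith [Real.pi_gt_three])
  linarith

/-- Upper Stirling bound: `log m! ≤ m log m − m + 1 + ½ log m` (`m ≥ 1`), from the monotonicity of the
Stirling sequence (`stirlingSeq m ≤ stirlingSeq 1 = e/√2`). -/
theorem log_factorial_le {m : ℕ} (hm : m ≠ 0) :
    Real.log m.factorial ≤ m * Real.log m - m + 1 + Real.log m / 2 := by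
  obtain ⟨j, rfl⟩ := Nat.exists_eq_succ_of_ne_zero hm
  have hanti : Stirling.stirlingSeq (j + 1) ≤ Stirling.stirlingSeq (0 + 1) :=
    Stirling.stirlingSeq'_antitone (Nat.zero_le j)
  rw [zero_add, Stirling.stirlingSeq_one] at hanti
  have hpos : 0 < Stirling.stirlingSeq (j + 1) := Stirling.stirlingSeq'_pos j
  have hlog : Real.log (Stirling.stirlingSeq (j + 1)) ≤ 1 - Real.log 2 / 2 := by
    have := Real.log_le_log hpos hanti
    rw [Real.log_div (Real.exp_pos 1).ne' (by positivity), Real.log_exp, Real.log_sqrt (by norm_num)]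
      at this
    linarith
  have hform := Stirling.log_stirlingSeq_formula (j + 1)
  have hm0 : (0 : ℝ) < ((j + 1 : ℕ) : ℝ) := by positivity
  rw [Real.log_mul (by norm_num) hm0.ne', Real.log_div hm0.ne' (Real.exp_pos 1).ne', Real.log_exp]
    at hform
  have : Real.log ((j + 1).factorial : ℝ) = Real.log (Stirling.stirlingSeq (j + 1)) +
      1 / 2 * (Real.log 2 + Real.log ((j + 1 : ℕ) : ℝ)) + ((j + 1 : ℕ) : ℝ) * (Real.log ((j + 1 : ℕ) : ℝ) - 1) := by
    linarith
  rw [this]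
  nlinarith [hlog]

/-- `J log n ≤ J log N` as soon as `J n ≤ N` and `n ≥ 1` (vacuous for `J = 0`). -/
theorem mul_log_le {J n N : ℕ} (hn : n ≠ 0) (h : J * n ≤ N) :
    (J : ℝ) * Real.log n ≤ J * Real.log N := by
  rcases Nat.eq_zero_or_pos J with hJ | hJ
  · simp [hJ]
  · have hnN : n ≤ N := le_trans (Nat.le_mul_of_pos_left n hJ) h
    have hn0 : (0 : ℝ) < n := by exact_mod_cast Nat.pos_of_ne_zero hn
    exact mul_le_mul_of_nonneg_left (Real.log_le_log hn0 (by exact_mod_cast hnN)) (Nat.cast_nonneg J)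

/-- **Stirling bookkeeping of the multinomial weight**: with `N = J₁n₁ + J₂n₂ + n₄ + R`, all
occupation numbers `≥ 1`,
`−log N! + J₁ log n₁! + J₂ log n₂! + log n₄! + log R!
   ≤ −N log N + J₁ n₁ log n₁ + J₂ n₂ log n₂ + n₄ log n₄ + R log R + (J₁ + J₂ + 2)(1 + ½ log N)`. -/
theorem neg_log_mult_le {N J₁ J₂ n₁ n₂ n₄ R : ℕ} (hsum : J₁ * n₁ + J₂ * n₂ + n₄ + R = N)
    (hn₁ : n₁ ≠ 0) (hn₂ : n₂ ≠ 0) (hn₄ : n₄ ≠ 0) (hR : R ≠ 0) :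
    -Real.log N.factorial + J₁ * Real.log n₁.factorial + J₂ * Real.log n₂.factorial +
        Real.log n₄.factorial + Real.log R.factorial ≤
      -((N : ℝ) * Real.log N) + J₁ * (n₁ * Real.log n₁) + J₂ * (n₂ * Real.log n₂) +
        n₄ * Real.log n₄ + R * Real.log R + ((J₁ : ℝ) + J₂ + 2) * (1 + Real.log N / 2) := by
  have hN : N ≠ 0 := by omega
  have hNr : ((J₁ * n₁ + J₂ * n₂ + n₄ + R : ℕ) : ℝ) = N := by exact_mod_cast hsum
  push_cast at hNr
  have e0 := log_factorial_ge hN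
  have e1 := log_factorial_le hn₁
  have e2 := log_factorial_le hn₂
  have e4 := log_factorial_le hn₄
  have eR := log_factorial_le hR
  have l1 : (J₁ : ℝ) * Real.log n₁ ≤ J₁ * Real.log N := mul_log_le hn₁ (by omega)
  have l2 : (J₂ : ℝ) * Real.log n₂ ≤ J₂ * Real.log N := mul_log_le hn₂ (by omega)
  have l4 : Real.log n₄ ≤ Real.log N :=
    Real.log_le_log (by exact_mod_cast Nat.pos_of_ne_zero hn₄) (by exact_mod_cast (show n₄ ≤ N by omega))
  have lR : Real.log R ≤ Real.log N :=
    Real.log_le_log (by exact_mod_cast Nat.pos_of_ne_zero hR) (by exact_mod_cast (show R ≤ N by omega))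
  have hJ₁ : (0 : ℝ) ≤ J₁ := Nat.cast_nonneg _
  have hJ₂ : (0 : ℝ) ≤ J₂ := Nat.cast_nonneg _
  have m1 := mul_le_mul_of_nonneg_left e1 hJ₁
  have m2 := mul_le_mul_of_nonneg_left e2 hJ₂
  nlinarith [m1, m2, e4, eR, e0, l1, l2, l4, lR, hNr]

/-! ### The rate estimate -/

/-- `x (log n − log N − 3 log s) ≤ x log c` when `0 ≤ x`, `0 < n`, `n ≤ c s³ N`. -/
theorem weight_log_le {x c s : ℝ} {n N : ℕ} (hx : 0 ≤ x) (hn : 0 < n) (hN : 0 < N) (hs : 0 < s)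
    (h : (n : ℝ) ≤ c * s ^ 3 * N) :
    x * (Real.log n - Real.log N - 3 * Real.log s) ≤ x * Real.log c := by
  refine mul_le_mul_of_nonneg_left ?_ hx
  have hn0 : (0 : ℝ) < n := by exact_mod_cast hn
  have hN0 : (0 : ℝ) < N := by exact_mod_cast hN
  have hq : (n : ℝ) / (N * s ^ 3) ≤ c := by
    rw [div_le_iff₀ (by positivity)]; linarith
  have hlog := Real.log_le_log (by positivity) hq
  rw [Real.log_div hn0.ne' (by positivity), Real.log_mul hN0.ne' (by positivity), Real.log_pow] at hlog
  push_cast at hlog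
  linarith

/-- **The rate estimate.** From the master inequality (hypothesis `hP`) with positive cell free
volumes, the rate at density `η` is bounded by the entropy of mixing plus the weighted cell rates plus
the Stirling corrections. [cite: Ruelle1969, §3.4] -/
theorem rate_le (η η₁ η₂ s F₁ F₂ F₄ FR FN : ℝ) (N k J₁ J₂ n₁ n₂ n₄ R : ℕ) (hη : 0 < η)
    (hs : 0 < s) (hF₁ : 0 < F₁) (hF₂ : 0 < F₂) (hF₄ : 0 < F₄)
    (hFR : 0 < FR) (hkJ : J₁ + J₂ + 2 = k ^ 3) (hsum : J₁ * n₁ + J₂ * n₂ + n₄ + R = N)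
    (hn₁ : n₁ ≠ 0) (hn₂ : n₂ ≠ 0) (hn₄ : n₄ ≠ 0) (hR0 : R ≠ 0)
    (h₁ : (n₁ : ℝ) * η ≤ η₁ * s ^ 3 * N) (h₂ : (n₂ : ℝ) * η ≤ η₂ * s ^ 3 * N)
    (h₄ : (n₄ : ℝ) * η ≤ η₂ * s ^ 3 * N) (hR2 : (R : ℝ) ≤ 2 * s ^ 3 * N)
    (hP : (N.factorial : ℝ) / ((n₁.factorial : ℝ) ^ J₁ * (n₂.factorial : ℝ) ^ J₂ * n₄.factorial *
        R.factorial) * s ^ (3 * N) * (F₁ ^ J₁ * F₂ ^ J₂ * F₄ * FR) ≤ FN) :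
    -(N : ℝ)⁻¹ * Real.log FN ≤
      (J₁ : ℝ) * n₁ / N * (Real.log (η₁ / η) + -(n₁ : ℝ)⁻¹ * Real.log F₁) +
      (J₂ : ℝ) * n₂ / N * (Real.log (η₂ / η) + -(n₂ : ℝ)⁻¹ * Real.log F₂) +
      (n₄ : ℝ) / N * (Real.log (η₂ / η) + -(n₄ : ℝ)⁻¹ * Real.log F₄) +
      (R : ℝ) / N * (Real.log 2 + -(R : ℝ)⁻¹ * Real.log FR) +
      (k : ℝ) ^ 3 * (1 + Real.log N / 2) / N := by
  have hN : N ≠ 0 := by omega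
  have hN0 : (0 : ℝ) < N := by exact_mod_cast Nat.pos_of_ne_zero hN
  have hNr : (J₁ : ℝ) * n₁ + J₂ * n₂ + n₄ + R = N := by exact_mod_cast hsum
  have hkr : (J₁ : ℝ) + J₂ + 2 = (k : ℝ) ^ 3 := by exact_mod_cast hkJ
  -- positivity of the multinomial weight and of P
  have hfac : ∀ m : ℕ, (0 : ℝ) < m.factorial := fun m => by exact_mod_cast m.factorial_pos
  set D : ℝ := (n₁.factorial : ℝ) ^ J₁ * (n₂.factorial : ℝ) ^ J₂ * n₄.factorial * R.factorial with hD
  have hD0 : 0 < D := by positivity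
  set P : ℝ := (N.factorial : ℝ) / D * s ^ (3 * N) * (F₁ ^ J₁ * F₂ ^ J₂ * F₄ * FR) with hPdef
  have hP0 : 0 < P := by positivity
  have hFN : 0 < FN := hP0.trans_le hP
  -- log P
  have hlogP : Real.log P = Real.log N.factorial - (J₁ * Real.log n₁.factorial +
      J₂ * Real.log n₂.factorial + Real.log n₄.factorial + Real.log R.factorial) +
      3 * N * Real.log s + (J₁ * Real.log F₁ + J₂ * Real.log F₂ + Real.log F₄ + Real.log FR) := by
    have hlogD : Real.log D = J₁ * Real.log n₁.factorial + J₂ * Real.log n₂.factorial +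
        Real.log n₄.factorial + Real.log R.factorial := by
      rw [hD, Real.log_mul (by positivity) (hfac R).ne', Real.log_mul (by positivity) (hfac n₄).ne',
        Real.log_mul (by positivity) (by positivity), Real.log_pow, Real.log_pow]
    have hlogF : Real.log (F₁ ^ J₁ * F₂ ^ J₂ * F₄ * FR) =
        J₁ * Real.log F₁ + J₂ * Real.log F₂ + Real.log F₄ + Real.log FR := by
      rw [Real.log_mul (by positivity) hFR.ne', Real.log_mul (by positivity) hF₄.ne',
        Real.log_mul (by positivity) (by positivity), Real.log_pow, Real.log_pow]
    rw [hPdef, Real.log_mul (by positivity) (by positivity), Real.log_mul (by positivity) (by positivity),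
      Real.log_div (hfac N).ne' hD0.ne', hlogD, hlogF, Real.log_pow]
    push_cast
    ring
  -- the rate at η is at most −(1/N) log P
  have hrate : -(N : ℝ)⁻¹ * Real.log FN ≤ -(N : ℝ)⁻¹ * Real.log P := by
    have := Real.log_le_log hP0 hP
    have hinv : -(N : ℝ)⁻¹ ≤ 0 := by simp [hN0.le]
    exact mul_le_mul_of_nonpos_left this hinv
  refine hrate.trans ?_
  -- Stirling bookkeeping
  have hmult := neg_log_mult_le hsum hn₁ hn₂ hn₄ hR0
  -- the mixing weights
  have hx₁ : (0 : ℝ) ≤ (J₁ : ℝ) * n₁ / N := by positivity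
  have hx₂ : (0 : ℝ) ≤ (J₂ : ℝ) * n₂ / N := by positivity
  have hx₄ : (0 : ℝ) ≤ (n₄ : ℝ) / N := by positivity
  have hxR : (0 : ℝ) ≤ (R : ℝ) / N := by positivity
  have hw₁ := weight_log_le (c := η₁ / η) hx₁ (Nat.pos_of_ne_zero hn₁) (Nat.pos_of_ne_zero hN) hs
    (by rw [div_mul_eq_mul_div, div_mul_eq_mul_div, le_div_iff₀ hη]; linarith)
  have hw₂ := weight_log_le (c := η₂ / η) hx₂ (Nat.pos_of_ne_zero hn₂) (Nat.pos_of_ne_zero hN) hs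
    (by rw [div_mul_eq_mul_div, div_mul_eq_mul_div, le_div_iff₀ hη]; linarith)
  have hw₄ := weight_log_le (c := η₂ / η) hx₄ (Nat.pos_of_ne_zero hn₄) (Nat.pos_of_ne_zero hN) hs
    (by rw [div_mul_eq_mul_div, div_mul_eq_mul_div, le_div_iff₀ hη]; linarith)
  have hwR := weight_log_le (c := 2) hxR (Nat.pos_of_ne_zero hR0) (Nat.pos_of_ne_zero hN) hs hR2
  -- expand −(1/N) log P and compare term by term
  have key : -(N : ℝ)⁻¹ * Real.log P =
      (N : ℝ)⁻¹ * (-Real.log N.factorial + J₁ * Real.log n₁.factorial + J₂ * Real.log n₂.factorial +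
        Real.log n₄.factorial + Real.log R.factorial) - 3 * Real.log s +
      (J₁ : ℝ) * n₁ / N * (-(n₁ : ℝ)⁻¹ * Real.log F₁) + (J₂ : ℝ) * n₂ / N * (-(n₂ : ℝ)⁻¹ * Real.log F₂) +
      (n₄ : ℝ) / N * (-(n₄ : ℝ)⁻¹ * Real.log F₄) + (R : ℝ) / N * (-(R : ℝ)⁻¹ * Real.log FR) := by
    rw [hlogP]
    have hn₁0 : (n₁ : ℝ) ≠ 0 := by exact_mod_cast hn₁
    have hn₂0 : (n₂ : ℝ) ≠ 0 := by exact_mod_cast hn₂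
    have hn₄0 : (n₄ : ℝ) ≠ 0 := by exact_mod_cast hn₄
    have hR00 : (R : ℝ) ≠ 0 := by exact_mod_cast hR0
    field_simp
    ring
  rw [key]
  -- the Stirling part
  have hS : (N : ℝ)⁻¹ * (-Real.log N.factorial + J₁ * Real.log n₁.factorial +
      J₂ * Real.log n₂.factorial + Real.log n₄.factorial + Real.log R.factorial) - 3 * Real.log s ≤
      (J₁ : ℝ) * n₁ / N * Real.log (η₁ / η) + (J₂ : ℝ) * n₂ / N * Real.log (η₂ / η) +
      (n₄ : ℝ) / N * Real.log (η₂ / η) + (R : ℝ) / N * Real.log 2 +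
      (k : ℝ) ^ 3 * (1 + Real.log N / 2) / N := by
    -- −(1/N)(…) ≤ (1/N)(−N log N + Σ m log m + k³(1 + ½ log N))
    have step1 : (N : ℝ)⁻¹ * (-Real.log N.factorial + J₁ * Real.log n₁.factorial +
        J₂ * Real.log n₂.factorial + Real.log n₄.factorial + Real.log R.factorial) ≤
        (N : ℝ)⁻¹ * (-((N : ℝ) * Real.log N) + J₁ * (n₁ * Real.log n₁) + J₂ * (n₂ * Real.log n₂) +
          n₄ * Real.log n₄ + R * Real.log R + ((J₁ : ℝ) + J₂ + 2) * (1 + Real.log N / 2)) :=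
      mul_le_mul_of_nonneg_left hmult (inv_nonneg.2 hN0.le)
    -- rewrite the right-hand side with the weights (Σ weights = 1)
    have step2 : (N : ℝ)⁻¹ * (-((N : ℝ) * Real.log N) + J₁ * (n₁ * Real.log n₁) + J₂ * (n₂ * Real.log n₂) +
          n₄ * Real.log n₄ + R * Real.log R + ((J₁ : ℝ) + J₂ + 2) * (1 + Real.log N / 2)) - 3 * Real.log s =
        (J₁ : ℝ) * n₁ / N * (Real.log n₁ - Real.log N - 3 * Real.log s) +
        (J₂ : ℝ) * n₂ / N * (Real.log n₂ - Real.log N - 3 * Real.log s) +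
        (n₄ : ℝ) / N * (Real.log n₄ - Real.log N - 3 * Real.log s) +
        (R : ℝ) / N * (Real.log R - Real.log N - 3 * Real.log s) +
        (k : ℝ) ^ 3 * (1 + Real.log N / 2) / N := by
      have hwN : (N : ℝ)⁻¹ * N = 1 := inv_mul_cancel₀ hN0.ne'
      linear_combination (3 * Real.log s) * hwN +
        (N : ℝ)⁻¹ * (Real.log N + 3 * Real.log s) * hNr + (N : ℝ)⁻¹ * (1 + Real.log N / 2) * hkr
    linarith [step1, step2, hw₁, hw₂, hw₄, hwR]
  linarith [hS]

end RuelleEstimate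

/-- **Registered helper sub-goal `ruelle_rate_le`** (the Stirling bookkeeping of the master inequality, in
closed form): see `RuelleEstimate.rate_le`. [cite: Ruelle1969, §3.4] -/
theorem ruelle_rate_le : ∀ (η η₁ η₂ s F₁ F₂ F₄ FR FN : ℝ) (N k J₁ J₂ n₁ n₂ n₄ R : ℕ), 0 < η → 0 < s → 0 < F₁ → 0 < F₂ → 0 < F₄ → 0 < FR → J₁ + J₂ + 2 = k ^ 3 → J₁ * n₁ + J₂ * n₂ + n₄ + R = N → n₁ ≠ 0 → n₂ ≠ 0 → n₄ ≠ 0 → R ≠ 0 → (n₁ : ℝ) * η ≤ η₁ * s ^ 3 * N → (n₂ : ℝ) * η ≤ η₂ * s ^ 3 * N → (n₄ : ℝ) * η ≤ η₂ * s ^ 3 * N → (R : ℝ) ≤ 2 * s ^ 3 * N → (N.factorial : ℝ) / ((n₁.factorial : ℝ) ^ J₁ * (n₂.factorial : ℝ) ^ J₂ * n₄.factorial * R.factorial) * s ^ (3 * N) * (F₁ ^ J₁ * F₂ ^ J₂ * F₄ * FR) ≤ FN → -(N : ℝ)⁻¹ * Real.log FN ≤ (J₁ : ℝ) * n₁ /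 N * (Real.log (η₁ / η) + -(n₁ : ℝ)⁻¹ * Real.log F₁) + (J₂ : ℝ) * n₂ / N * (Real.log (η₂ / η) + -(n₂ : ℝ)⁻¹ * Real.log F₂) + (n₄ : ℝ) / N * (Real.log (η₂ / η) + -(n₄ : ℝ)⁻¹ * Real.log F₄) + (R : ℝ) / N * (Real.log 2 + -(R : ℝ)⁻¹ * Real.log FR) + (k : ℝ) ^ 3 * (1 + Real.log N / 2) / N :=
  RuelleEstimate.rate_le

end Barycentric

end Summit.AtomisticToContinuum.HydrodynamicLimit.Theorems.MacroClosureLine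

end
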